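import Summits.ABC.IUTFork.Repair.RHReachLedgerRealise
import HarnessLib

/-!
# R-H ROUND 2, row 27 «reach-ledger» — (α) REALISATION, PER-PRIME FORM: the pooled level weights and the place-sum bound at ONE
# prime `p`, from a certified dictionary AT `p` ONLY (so the door needs no dictionary at primes without a bad place)

PROOF-ONLY file (0 definitions, 0 `Prop` facts; abc-iut cell, D-0079 RESCUE sub-cell R-H, rung LADDER-ABC:A2.RESCUE.H; ROUND-2 seat
abc-iut-rh2-L1 gen 2 = row 27's lemma-L1 seat). TAKES NO SIDE on [IUTchIII] Cor. 3.12 or on any author; typed ≠ proved; instantiated ≠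
endorsed; nothing here asserts abc proved or refuted. Companion of `Repair/RHReachLedgerRealise.lean` (p475227, gen 0): there
`levelWeightsAt_reached` and `ReachLedgerDoor.placeSum_le_cellSlack` (p475842) take a UNIFORM CERTIFIED DICTIONARY AT EVERY PRIME —
index `e_p ≥ 1`, norm uniformizers `‖ϖ_x‖ = p^{−1/e_p}`, an inner certificate `A_p` and an outer certificate `B_p ≤ A_p` at every
`x ∣ p` — although the conclusion at the packet `(i+1, p)` reads the dictionary AT `p` ONLY. At a prime WITHOUT a bad place the cell
slack is nonnegative for free (abc-iut-rh-typ-10's `RH.ReachLedgerBookkeeping.cellSlack_nonneg_settingPrVolSharp_of_good`, identity movers),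
and a certified uniform dictionary need not even exist there (non-uniform fibres; inner/outer TIES, e.g. every place over `2` is an
inner tie since `(2−1) ∣ e`). HENCE THIS FILE: the same two theorems with every dictionary hypothesis asked at the ONE prime `p` of
the conclusion (the families `eK, AK, BK, ϖ` stay total; their values off `p` are never read):
* §1 `levelWeightsAt_reached_at` — (α) at `p`: the pooled level weights of abc-iut-rp-d3's box-free door carry the reached idele
  `t_q·ϖ^{−s}` at every summand of the packet `(i+1, p)` (proof = gen 0's, verbatim, hypotheses localised);
* §2 `placeSum_le_cellSlack_at` — `(log p/e_p)·Σ_{v∣p} (n_v/[F:ℚ])·s(p,i,v) ≤ σ_{i+1,p}` from the dictionary at `p` (+ the global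
  side conditions `ϖ ≠ 0`, `s = 0` off `S`, which make `t_q·ϖ^{−s}` an idele of the setting).
The W-relative doors (`statement_of_placeLedger_on`, `statement_of_hStarReachLedger_on`: dictionary and column domination at the
primes UNDER a bad place only) are the sequel `Repair/RHReachLedgerDoorLocal.lean`. OUR typed objects throughout (Dupuy–Hilado (Ind2) =
all `ℤ_p`-lattice automorphisms — STRONGER-THAN-PRINT; sharp boxes; hull-level (xi-f)); the certificates are HYPOTHESES here.
[cite: DupuyHilado2025, §3.6, §3.9, §4.9] [cite: WeilBNT1967, Ch. II §2, Th. 1]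
[cite: Mochizuki2012, IUTchIII Prop. 3.9 (i) p. 116, Rmk. 3.9.3 pp. 119–120, Cor. 3.12 p. 173–174, Step (xi-f) p. 184] [claim: Mochizuki2012, status: disputed]
-/

noncomputable section

open Set Function
open scoped Pointwise

namespace Summit.ABC.IUTFork.Repair.RH.ReachLedgerRealise

open Cor312 Cor312Vol Literature.IUT.LogThetaLattice Literature.IUT.LogVolume NumberField IsDedekindDomain
  Summit.ABC.IUTFork.Thm311 Summit.ABC.IUTFork.Thm311.Real

section Sharp

variable {F : Type} [Field F] [NumberField F] (X : PilotData F) {logv : PadicLogs F} (hlog : LogvAnalytic logv)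
  (M : Type) [Field M] [NumberField M]
  (archPk : ∀ (j : (thetaIndex X).Label) (vQ : (thetaIndex X).VQ), Set ((logShellsDH X logv).Packet j vQ))
  (archSub : ∀ (j : (thetaIndex X).Label) (v : (thetaIndex X).V),
    Set ((logShellsDH X logv).Packet j ((thetaIndex X).over v)))
  (Ψ : ℤ → ∀ v : (thetaIndex X).V, v ∈ (thetaIndex X).Vbad → Set ((logShellsDH X logv).StarPacket v))
  (act : ℤ → ∀ v : (thetaIndex X).V, v ∈ (thetaIndex X).Vbad →
    (logShellsDH X logv).StarPacket v → Module.End ℚ ((logShellsDH X logv).StarPacket v))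
  (Mmod : ℤ → ∀ j : (thetaIndex X).LabelStar, Set ((logShellsDH X logv).GlobalPacket j.1))
  (region : ℤ → ∀ j : (thetaIndex X).LabelStar, FinDivisor M → ∀ vQ : (thetaIndex X).VQ,
    Set ((logShellsDH X logv).Packet j.1 vQ))
  (n : ℤ) {HT : Type} {LogLink : HT → HT → Type} {IsFull : ∀ {s t : HT}, LogLink s t → Prop}
  (lat : LGPGaussianLogThetaLattice LogLink IsFull)
  {Frd : Type} {IsoF : Frd → Frd → Type} {Ob : Frd → Type} {realify : Frd → Frd} {Strip : Type}
  {IsoS : Strip → Strip → Type} {Mv : ∀ v : (thetaIndex X).V, v ∈ (thetaIndex X).Vbad → Type}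
  [∀ v h, Monoid (Mv v h)]
  (sig : GlobalLGPFrobenioidSignature (thetaIndex X).lstar (thetaIndex X).V (· ∈ (thetaIndex X).Vbad)
    Frd IsoF Ob realify Strip IsoS Mv)
  (split : SplittingMonoids Mv) {ObΔ : Type} {N : ∀ v : (thetaIndex X).V, v ∈ (thetaIndex X).Vbad → Type}
  [∀ v h, Monoid (N v h)] (qData : QPilotData ObΔ N)
  (tq : ∀ (pp : Nat.Primes) (x : (thetaIndex X).Fibre (.inr pp)), haveI : Fact (pp : ℕ).Prime := ⟨pp.2⟩; kOf X pp.1 x)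
  (t : ∀ (pp : Nat.Primes) (_ : Fin X.lstar) (x : (thetaIndex X).Fibre (.inr pp)),
    haveI : Fact (pp : ℕ).Prime := ⟨pp.2⟩; kOf X pp.1 x)
  (htq0 : ∀ pp x, tq pp x ≠ 0)
  (htq1 : ∀ (pp : Nat.Primes) (x : (thetaIndex X).Fibre (.inr pp)),
    haveI : Fact (pp : ℕ).Prime := ⟨pp.2⟩; placeOf X pp.1 x ∉ X.S → ‖tq pp x‖ = 1)

section Dictionary

variable (eK AK : Nat.Primes → ℕ) (BK : Nat.Primes → ℤ)
  (ϖ : ∀ (pp : Nat.Primes) (x : (thetaIndex X).Fibre (.inr pp)), haveI : Fact (pp : ℕ).Prime := ⟨pp.2⟩; kOf X pp.1 x)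
  (mΘ : ∀ pp : Nat.Primes, Fin (thetaIndex X).lstar → (thetaIndex X).Fibre (.inr pp) → ℤ)
  (mq : ∀ pp : Nat.Primes, (thetaIndex X).Fibre (.inr pp) → ℤ)
  (s : ∀ pp : Nat.Primes, Fin (thetaIndex X).lstar → (thetaIndex X).Fibre (.inr pp) → ℤ)

/-! ## §1. (α) AT ONE PRIME: the level weights that realise a surplus `s`, dictionary certified at `p` only -/

include htq0 in
/-- The reached idele `t_q·ϖ^{−s}` is nonzero as soon as every `ϖ_x ≠ 0` (no norm formula needed off the prime of interest). [folklore] -/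
theorem reached_ne_zero_of_ne_zero (hϖ0 : ∀ pp x, ϖ pp x ≠ 0) (i : Fin (thetaIndex X).lstar) (pp : Nat.Primes)
    (x : (thetaIndex X).Fibre (.inr pp)) :
    haveI : Fact (pp : ℕ).Prime := ⟨pp.2⟩
    tq pp x * ϖ pp x ^ (-(s pp i x)) ≠ 0 :=
  mul_ne_zero (htq0 pp x) (zpow_ne_zero _ (hϖ0 pp x))

include htq1 in
/-- **(α) REALISATION AT ONE PRIME `p`.** As `levelWeightsAt_reached` (gen 0, p475227), but the certified dictionary is asked AT `p` ONLY:
`e_p ≥ 1`, `B_p ≤ A_p`, norm uniformizers `‖ϖ_x‖ = p^{−1/e_p}` for `x ∣ p`, an inner certificate (a NON-log-unit `u_x` with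
`‖u_x‖ ≤ ‖ϖ_x‖^{A_p−1}` at every `x ∣ p`) and an outer certificate (a log-unit `z_x` with `‖z_x‖ ≥ p^{−B_p/e_p}`); the Θ- and q-orders
`mΘ`, `mq` at the bad places over `p` and integer surpluses `s(p,i,x)`, `= 0` off `S`, `≤ mq − (i+2)·B_p − e_p·⌈(mΘ − (i+2)(A_p+e_p−1))/e_p⌉`
at the bad `w ∣ p`. THEN the data of abc-iut-rp-d3's `qRegion_subset_thetaHull_settingPrVolSharp_of_levelWeightsAt` exist at the packet
`(i+1, p)` for the idele `t_q·ϖ^{−s(p,i,·)}`: `y_a = u_{v_a}`, `z_a = z_{v_a}`, `k_a = 0` on the donor slots and the pooled level count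
`k = ⌈(MΘ − (i+2)(A_p+e_p−1))/e_p⌉` on the last slot. Proof verbatim from gen 0 with the hypotheses localised; two-sided in `s`.
[cite: DupuyHilado2025, §3.9, §4.9] [cite: WeilBNT1967, Ch. II §2, Th. 1] [claim: Mochizuki2012, status: disputed] -/
theorem levelWeightsAt_reached_at (pp : Nat.Primes) (he : 1 ≤ eK pp) (hBA : BK pp ≤ (AK pp : ℤ))
    (hϖ : ∀ x : (thetaIndex X).Fibre (.inr pp), haveI : Fact (pp : ℕ).Prime := ⟨pp.2⟩
      ‖ϖ pp x‖ = ((pp : ℕ) : ℝ) ^ (-(1 : ℝ) / (eK pp : ℝ)))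
    (hsharp : ∀ x : (thetaIndex X).Fibre (.inr pp), haveI : Fact (pp : ℕ).Prime := ⟨pp.2⟩
      ∃ u : kOf X pp.1 x, ‖u‖ ≤ ‖ϖ pp x‖ ^ ((AK pp : ℤ) - 1) ∧ u ∉ (logUnits (kOf X pp.1 x) : Set (kOf X pp.1 x)))
    (hrad : ∀ x : (thetaIndex X).Fibre (.inr pp), haveI : Fact (pp : ℕ).Prime := ⟨pp.2⟩
      ∃ z ∈ (logUnits (kOf X pp.1 x) : Set (kOf X pp.1 x)), ((pp : ℕ) : ℝ) ^ (-(BK pp : ℝ) / (eK pp : ℝ)) ≤ ‖z‖)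
    (ht1 : ∀ (pp : Nat.Primes) (i : Fin X.lstar) (x : (thetaIndex X).Fibre (.inr pp)),
      haveI : Fact (pp : ℕ).Prime := ⟨pp.2⟩; placeOf X pp.1 x ∉ X.S → ‖t pp i x‖ = 1)
    (hΘ : ∀ (pp : Nat.Primes) (i : Fin X.lstar) (w : (thetaIndex X).Fibre (.inr pp)), haveI : Fact (pp : ℕ).Prime := ⟨pp.2⟩
      placeOf X pp.1 w ∈ X.S → ‖t pp i w‖ = ‖ϖ pp w‖ ^ (mΘ pp i w))
    (hq : ∀ (pp : Nat.Primes) (w : (thetaIndex X).Fibre (.inr pp)), haveI : Fact (pp : ℕ).Prime := ⟨pp.2⟩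
      placeOf X pp.1 w ∈ X.S → ‖tq pp w‖ = ‖ϖ pp w‖ ^ (mq pp w))
    (hs0 : ∀ (pp : Nat.Primes) (i : Fin (thetaIndex X).lstar) (x : (thetaIndex X).Fibre (.inr pp)),
      haveI : Fact (pp : ℕ).Prime := ⟨pp.2⟩; placeOf X pp.1 x ∉ X.S → s pp i x = 0)
    (hs : ∀ (pp : Nat.Primes) (i : Fin (thetaIndex X).lstar) (w : (thetaIndex X).Fibre (.inr pp)),
      haveI : Fact (pp : ℕ).Prime := ⟨pp.2⟩; placeOf X pp.1 w ∈ X.S →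
        s pp i w ≤ mq pp w - ((i : ℤ) + 2) * BK pp -
          (eK pp : ℤ) * (-((-(mΘ pp i w - ((i : ℤ) + 2) * ((AK pp : ℤ) + eK pp - 1))) / (eK pp : ℤ))))
    (i : Fin (thetaIndex X).lstar)
    (e : (thetaIndex X).Caps (Setting.labelSucc i) → (thetaIndex X).Fibre (.inr pp)) :
    haveI : Fact (pp : ℕ).Prime := ⟨pp.2⟩
    ∃ (y z : ∀ a, kOf X pp.1 (e a)) (k : (thetaIndex X).Caps (Setting.labelSucc i) → ℤ),
      (∀ a, y a ∉ (logUnits (kOf X pp.1 (e a)) : Set (kOf X pp.1 (e a)))) ∧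
      (∀ a, z a ∈ (logUnits (kOf X pp.1 (e a)) : Set (kOf X pp.1 (e a)))) ∧
      (∏ a, ((pp : ℕ) : ℝ) ^ (-(k a + 1)) * ‖y a‖ ≤ ‖t pp i (e (Fin.last _))‖) ∧
      ‖tq pp (e (Fin.last _)) * ϖ pp (e (Fin.last _)) ^ (-(s pp i (e (Fin.last _))))‖ ≤
        ∏ a, ((pp : ℕ) : ℝ) ^ (-(k a)) * ‖z a‖ := by
  haveI : Fact (pp : ℕ).Prime := ⟨pp.2⟩
  classical
  have hp1 : (1 : ℝ) < (pp : ℕ) := by exact_mod_cast pp.2.one_lt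
  have hp0 : (0 : ℝ) < (pp : ℕ) := by positivity
  have he0 : (0 : ℝ) < (eK pp : ℝ) := by exact_mod_cast he
  have he1 : (1 : ℤ) ≤ (eK pp : ℤ) := by exact_mod_cast he
  choose u hu_norm hu_not using hsharp
  choose z hz_mem hz_norm using hrad
  set w := e (Fin.last _) with hw
  have hϖ0 : ϖ pp w ≠ 0 := by rw [← norm_pos_iff, hϖ w]; exact Real.rpow_pos_of_pos hp0 _
  -- uniform reading of the two idele orders at the last place (`MΘ = Mq = 0` at a good place)
  obtain ⟨MΘ, Mq, hMΘ, hMq, hsle⟩ : ∃ MΘ Mq : ℤ, ‖t pp i w‖ = ‖ϖ pp w‖ ^ MΘ ∧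
      ‖tq pp w * ϖ pp w ^ (-(s pp i w))‖ = ‖ϖ pp w‖ ^ (Mq - s pp i w) ∧
      s pp i w ≤ Mq - ((i : ℤ) + 2) * BK pp -
        (eK pp : ℤ) * (-((-(MΘ - ((i : ℤ) + 2) * ((AK pp : ℤ) + eK pp - 1))) / (eK pp : ℤ))) := by
    by_cases hbad : placeOf X pp.1 w ∈ X.S
    · refine ⟨mΘ pp i w, mq pp w, hΘ pp i w hbad, ?_, hs pp i w hbad⟩
      rw [norm_mul, norm_zpow, hq pp w hbad, ← zpow_add₀ (norm_ne_zero_iff.mpr hϖ0), sub_eq_add_neg]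
    · refine ⟨0, 0, ?_, ?_, ?_⟩
      · rw [zpow_zero]; exact ht1 pp i w hbad
      · rw [hs0 pp i w hbad, neg_zero, zpow_zero, mul_one, sub_zero, zpow_zero]; exact htq1 pp w hbad
      · rw [hs0 pp i w hbad]
        have h1 := RHLevelMover.mul_neg_ediv_neg_le (eK pp) he (0 - ((i : ℤ) + 2) * ((AK pp : ℤ) + eK pp - 1))
        have hi : (0 : ℤ) ≤ (i : ℤ) := by positivity
        have h2 : 0 ≤ ((i : ℤ) + 2) * ((AK pp : ℤ) - BK pp) := mul_nonneg (by linarith) (sub_nonneg.mpr hBA)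
        have h3 : 0 ≤ ((i : ℤ) + 1) * ((eK pp : ℤ) - 1) := mul_nonneg (by linarith) (by linarith)
        nlinarith [h1, h2, h3]
  -- the pooled level count, carried by the last slot
  set K : ℤ := -((-(MΘ - ((i : ℤ) + 2) * ((AK pp : ℤ) + eK pp - 1))) / (eK pp : ℤ)) with hK
  have hKY : MΘ - ((i : ℤ) + 2) * ((AK pp : ℤ) + eK pp - 1) ≤ (eK pp : ℤ) * K := RHSlotReach.le_mul_ceilDiv he1 _
  set k : (thetaIndex X).Caps (Setting.labelSucc i) → ℤ := fun a => if a = Fin.last _ then K else 0 with hkdef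
  have hksum : ∑ a, k a = K := by
    show ∑ a, (if a = Fin.last _ then K else 0) = K
    rw [Finset.sum_ite_eq']
    simp only [Finset.mem_univ, if_true]
  have hcard : (Finset.univ : Finset ((thetaIndex X).Caps (Setting.labelSucc i))).card = (i : ℕ) + 2 := by
    rw [Finset.card_univ, card_caps_labelSucc]
  -- norms in `p`-exponent form
  have hϖzpow := norm_varpi_zpow X eK ϖ pp hϖ
  have hzpow_rpow : ∀ m : ℤ, ((pp : ℕ) : ℝ) ^ m = ((pp : ℕ) : ℝ) ^ (((m * (eK pp : ℤ) : ℤ) : ℝ) / (eK pp : ℝ)) := by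
    intro m
    rw [← Real.rpow_intCast]
    congr 1
    push_cast
    field_simp
  have hu_le : ∀ x, ‖u x‖ ≤ ((pp : ℕ) : ℝ) ^ (-(((AK pp : ℤ) - 1 : ℤ) : ℝ) / (eK pp : ℝ)) := fun x => by
    have h := hu_norm x; rwa [hϖzpow] at h
  refine ⟨fun a => u (e a), fun a => z (e a), k, fun a => hu_not (e a), fun a => hz_mem (e a), ?_, ?_⟩
  · -- THE POOLED BOX: `Π_a p^{−(k_a+1)}·‖u_{v_a}‖ ≤ p^{(−(K+i+2)·e − (i+2)(A−1))/e} ≤ p^{−MΘ/e} = ‖t_{Θ,i+1,w}‖`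
    have hfac : ∀ a, ((pp : ℕ) : ℝ) ^ (-(k a + 1)) * ‖u (e a)‖ ≤
        ((pp : ℕ) : ℝ) ^ ((((-(k a + 1)) * (eK pp : ℤ) - ((AK pp : ℤ) - 1) : ℤ) : ℝ) / (eK pp : ℝ)) := by
      intro a
      calc ((pp : ℕ) : ℝ) ^ (-(k a + 1)) * ‖u (e a)‖
          ≤ ((pp : ℕ) : ℝ) ^ (-(k a + 1)) * ((pp : ℕ) : ℝ) ^ (-(((AK pp : ℤ) - 1 : ℤ) : ℝ) / (eK pp : ℝ)) :=
            mul_le_mul_of_nonneg_left (hu_le (e a)) (zpow_nonneg hp0.le _)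
        _ = ((pp : ℕ) : ℝ) ^ ((((-(k a + 1)) * (eK pp : ℤ) - ((AK pp : ℤ) - 1) : ℤ) : ℝ) / (eK pp : ℝ)) := by
            rw [hzpow_rpow, ← Real.rpow_add hp0]
            congr 1
            push_cast
            ring
    have hsum : (∑ a, ((-(k a + 1)) * (eK pp : ℤ) - ((AK pp : ℤ) - 1))) ≤ -MΘ := by
      have hrw : ∀ a, (-(k a + 1)) * (eK pp : ℤ) - ((AK pp : ℤ) - 1) =
          -(eK pp : ℤ) * k a + (-(eK pp : ℤ) - ((AK pp : ℤ) - 1)) := fun a => by ring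
      simp only [hrw, Finset.sum_add_distrib, ← Finset.mul_sum, hksum, Finset.sum_const, hcard, nsmul_eq_mul]
      push_cast
      linarith [hKY]
    calc ∏ a, ((pp : ℕ) : ℝ) ^ (-(k a + 1)) * ‖u (e a)‖
        ≤ ∏ a, ((pp : ℕ) : ℝ) ^ ((((-(k a + 1)) * (eK pp : ℤ) - ((AK pp : ℤ) - 1) : ℤ) : ℝ) / (eK pp : ℝ)) :=
          Finset.prod_le_prod (fun a _ => mul_nonneg (zpow_nonneg hp0.le _) (norm_nonneg _)) fun a _ => hfac a
      _ = ((pp : ℕ) : ℝ) ^ (∑ a, (((-(k a + 1)) * (eK pp : ℤ) - ((AK pp : ℤ) - 1) : ℤ) : ℝ) / (eK pp : ℝ)) :=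
          (Real.rpow_sum_of_pos hp0 _ _).symm
      _ ≤ ((pp : ℕ) : ℝ) ^ (-(MΘ : ℝ) / (eK pp : ℝ)) := by
          refine Real.rpow_le_rpow_of_exponent_le hp1.le ?_
          rw [← Finset.sum_div]
          refine div_le_div_of_nonneg_right ?_ he0.le
          exact_mod_cast hsum
      _ = ‖t pp i w‖ := by rw [hMΘ, hϖzpow]
  · -- THE REACH: `‖t_q·ϖ^{−s}‖ = p^{−(Mq−s)/e} ≤ p^{(−K·e − (i+2)·B)/e} ≤ Π_a p^{−k_a}·‖z_{v_a}‖`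
    have hfac : ∀ a, ((pp : ℕ) : ℝ) ^ ((((-(k a)) * (eK pp : ℤ) - BK pp : ℤ) : ℝ) / (eK pp : ℝ)) ≤
        ((pp : ℕ) : ℝ) ^ (-(k a)) * ‖z (e a)‖ := by
      intro a
      calc ((pp : ℕ) : ℝ) ^ ((((-(k a)) * (eK pp : ℤ) - BK pp : ℤ) : ℝ) / (eK pp : ℝ))
          = ((pp : ℕ) : ℝ) ^ (-(k a)) * ((pp : ℕ) : ℝ) ^ (-(BK pp : ℝ) / (eK pp : ℝ)) := by
            rw [hzpow_rpow, ← Real.rpow_add hp0]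
            congr 1
            push_cast
            ring
        _ ≤ ((pp : ℕ) : ℝ) ^ (-(k a)) * ‖z (e a)‖ := mul_le_mul_of_nonneg_left (hz_norm (e a)) (zpow_nonneg hp0.le _)
    have hsum : -(Mq - s pp i w) ≤ ∑ a, ((-(k a)) * (eK pp : ℤ) - BK pp) := by
      have hrw : ∀ a, (-(k a)) * (eK pp : ℤ) - BK pp = -(eK pp : ℤ) * k a + (-(BK pp)) := fun a => by ring
      simp only [hrw, Finset.sum_add_distrib, ← Finset.mul_sum, hksum, Finset.sum_const, hcard, nsmul_eq_mul]
      push_cast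
      linarith [hsle]
    calc ‖tq pp w * ϖ pp w ^ (-(s pp i w))‖
        = ((pp : ℕ) : ℝ) ^ (-((Mq - s pp i w : ℤ) : ℝ) / (eK pp : ℝ)) := by rw [hMq, hϖzpow]
      _ ≤ ((pp : ℕ) : ℝ) ^ (∑ a, (((-(k a)) * (eK pp : ℤ) - BK pp : ℤ) : ℝ) / (eK pp : ℝ)) := by
          refine Real.rpow_le_rpow_of_exponent_le hp1.le ?_
          rw [← Finset.sum_div]
          refine div_le_div_of_nonneg_right ?_ he0.le
          exact_mod_cast hsum
      _ = ∏ a, ((pp : ℕ) : ℝ) ^ ((((-(k a)) * (eK pp : ℤ) - BK pp : ℤ) : ℝ) / (eK pp : ℝ)) :=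
          Real.rpow_sum_of_pos hp0 _ _
      _ ≤ ∏ a, ((pp : ℕ) : ℝ) ^ (-(k a)) * ‖z (e a)‖ :=
          Finset.prod_le_prod (fun a _ => (Real.rpow_pos_of_pos hp0 _).le) fun a _ => hfac a

/-! ## §2. The place-sum bound at ONE prime from the dictionary at that prime -/

/-- **PLACE SUM ≤ CELL SLACK, dictionary certified AT `p` ONLY.** At `settingPrVolSharp` (bridge hypotheses), with `ϖ_x ≠ 0` everywhere and
integer surpluses `s` vanishing off `S` (so that `t_q·ϖ^{−s}` is an idele of the setting), and AT THE PRIME `p`: `e_p ≥ 1`, `B_p ≤ A_p`,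
`‖ϖ_x‖ = p^{−1/e_p}`, the inner/outer certificates and the surplus bounds at the bad `w ∣ p` — then
`(log p / e_p) · Σ_{v ∣ p} (n_v/[F:ℚ])·s(p,i,v) ≤ σ_{i+1,p} := logvol(ⁿ˒°𝒰_{i+1,p}) − qLocal_{i+1,p}` (gen 0's `ReachLedgerDoor.placeSum_le_cellSlack`,
p475842, over §1 instead of the global `levelWeightsAt_reached`). [cite: DupuyHilado2025, §3.6, §3.9, §4.9] [claim: Mochizuki2012, status: disputed] -/
theorem placeSum_le_cellSlack_at (ht0 : ∀ pp i x, t pp i x ≠ 0) (hϖ0 : ∀ pp x, ϖ pp x ≠ 0)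
    (ht1 : ∀ (pp : Nat.Primes) (i : Fin X.lstar) (x : (thetaIndex X).Fibre (.inr pp)),
      haveI : Fact (pp : ℕ).Prime := ⟨pp.2⟩; placeOf X pp.1 x ∉ X.S → ‖t pp i x‖ = 1)
    (hΘ : ∀ (pp : Nat.Primes) (i : Fin X.lstar) (w : (thetaIndex X).Fibre (.inr pp)), haveI : Fact (pp : ℕ).Prime := ⟨pp.2⟩
      placeOf X pp.1 w ∈ X.S → ‖t pp i w‖ = ‖ϖ pp w‖ ^ (mΘ pp i w))
    (hq : ∀ (pp : Nat.Primes) (w : (thetaIndex X).Fibre (.inr pp)), haveI : Fact (pp : ℕ).Prime := ⟨pp.2⟩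
      placeOf X pp.1 w ∈ X.S → ‖tq pp w‖ = ‖ϖ pp w‖ ^ (mq pp w))
    (hs0 : ∀ (pp : Nat.Primes) (i : Fin (thetaIndex X).lstar) (x : (thetaIndex X).Fibre (.inr pp)),
      haveI : Fact (pp : ℕ).Prime := ⟨pp.2⟩; placeOf X pp.1 x ∉ X.S → s pp i x = 0)
    (hs : ∀ (pp : Nat.Primes) (i : Fin (thetaIndex X).lstar) (w : (thetaIndex X).Fibre (.inr pp)),
      haveI : Fact (pp : ℕ).Prime := ⟨pp.2⟩; placeOf X pp.1 w ∈ X.S →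
        s pp i w ≤ mq pp w - ((i : ℤ) + 2) * BK pp -
          (eK pp : ℤ) * (-((-(mΘ pp i w - ((i : ℤ) + 2) * ((AK pp : ℤ) + eK pp - 1))) / (eK pp : ℤ))))
    (HB : BridgeHyps (settingPrVolSharp X hlog M archPk archSub Ψ act Mmod region n lat sig split qData tq t htq0 htq1))
    (pp : Nat.Primes) (he : 1 ≤ eK pp) (hBA : BK pp ≤ (AK pp : ℤ))
    (hϖ : ∀ x : (thetaIndex X).Fibre (.inr pp), haveI : Fact (pp : ℕ).Prime := ⟨pp.2⟩
      ‖ϖ pp x‖ = ((pp : ℕ) : ℝ) ^ (-(1 : ℝ) / (eK pp : ℝ)))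
    (hsharp : ∀ x : (thetaIndex X).Fibre (.inr pp), haveI : Fact (pp : ℕ).Prime := ⟨pp.2⟩
      ∃ u : kOf X pp.1 x, ‖u‖ ≤ ‖ϖ pp x‖ ^ ((AK pp : ℤ) - 1) ∧ u ∉ (logUnits (kOf X pp.1 x) : Set (kOf X pp.1 x)))
    (hrad : ∀ x : (thetaIndex X).Fibre (.inr pp), haveI : Fact (pp : ℕ).Prime := ⟨pp.2⟩
      ∃ z ∈ (logUnits (kOf X pp.1 x) : Set (kOf X pp.1 x)), ((pp : ℕ) : ℝ) ^ (-(BK pp : ℝ) / (eK pp : ℝ)) ≤ ‖z‖)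
    (i : Fin (thetaIndex X).lstar) :
    haveI : Fact (pp : ℕ).Prime := ⟨pp.2⟩
    Real.log ((pp : ℕ) : ℝ) / (eK pp : ℝ) *
        ∑ v : ↥(placesOver F pp), weight F v.1 * (s pp i ((fibreEquivPlacesOver X pp).symm v) : ℝ) ≤
      ((situationPrVol X hlog M archPk archSub Ψ act Mmod region).D n).logvol (Setting.labelSucc i) (.inr pp)
          ((settingPrVolSharp X hlog M archPk archSub Ψ act Mmod region n lat sig split qData tq t htq0 htq1).thetaHull (Setting.labelSucc i) (.inr pp)) -
        (settingPrVolSharp X hlog M archPk archSub Ψ act Mmod region n lat sig split qData tq t htq0 htq1).qLocal (Setting.labelSucc i) (.inr pp) := by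
  haveI : Fact (pp : ℕ).Prime := ⟨pp.2⟩
  have hp0 : (0 : ℝ) < (pp : ℕ) := by exact_mod_cast pp.2.pos
  have hgain := reachGain_le_cellSlack_of_levelWeightsAt X hlog M archPk archSub Ψ act Mmod region n lat sig split qData tq t htq0 htq1
    ht0 pp i (fun pp x => tq pp x * ϖ pp x ^ (-(s pp i x))) (reached_ne_zero_of_ne_zero X tq htq0 ϖ s hϖ0 i)
    (norm_reached_eq_one_of_good X tq htq1 ϖ s hs0 i)
    (fun e => levelWeightsAt_reached_at X tq t htq1 eK AK BK ϖ mΘ mq s pp he hBA hϖ hsharp hrad ht1 hΘ hq hs0 hs i e) HB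
  -- per summand the gain is `(s(v_{i+1})/e_p)·log p`
  have hterm : ∀ e : (presAt X hlog pp).toLocalPieces.E (Setting.labelSucc i),
      weightPr X pp.1 (Setting.labelSucc i) e *
          (Real.log ‖tq pp (e (Fin.last _)) * ϖ pp (e (Fin.last _)) ^ (-(s pp i (e (Fin.last _))))‖ -
            Real.log ‖tq pp (e (Fin.last _))‖) =
        Real.log ((pp : ℕ) : ℝ) / (eK pp : ℝ) * (weightPr X pp.1 (Setting.labelSucc i) e * (s pp i (e (Fin.last _)) : ℝ)) := by
    intro e
    have htqpos : 0 < ‖tq pp (e (Fin.last _))‖ := norm_pos_iff.mpr (htq0 pp _)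
    have hϖpow : ‖ϖ pp (e (Fin.last _)) ^ (-(s pp i (e (Fin.last _))))‖ =
        ((pp : ℕ) : ℝ) ^ ((s pp i (e (Fin.last _)) : ℝ) / (eK pp : ℝ)) := by
      rw [norm_zpow, norm_varpi_zpow X eK ϖ pp hϖ (e (Fin.last _))]
      congr 1
      push_cast
      ring
    rw [norm_mul, hϖpow, Real.log_mul htqpos.ne' (Real.rpow_pos_of_pos hp0 _).ne', Real.log_rpow hp0]
    ring
  rw [Finset.sum_congr rfl fun e _ => hterm e, ← Finset.mul_sum,
    sum_weightPr_mul_apply_last X hlog pp (Setting.labelSucc i) (fun x => (s pp i x : ℝ))] at hgain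
  exact hgain

end Dictionary

end Sharp

end Summit.ABC.IUTFork.Repair.RH.ReachLedgerRealise

end
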